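import Literature.NumberTheory.LFunctions.ZetaLogDerivSeries
import Summits.RiemannHypothesis.RiemannHypothesis.Theorems.JensenLogBandArcTransform
import Summits.RiemannHypothesis.RiemannHypothesis.Theorems.JensenLogBandGammaFactorStirling
import HarnessLib

/-!
# The `Γ`-factor `γ̃` of `ξ` and the model phase of the BAND line's arc integrand

RH ladder column JENSEN, rung J-P(P3) «log band», BAND crux `XiDerivBandRealAllRates` of route
«JensenLogBand», line «band-one-window» (u-arc reshape), lead rh-jensen-prover g7 — vocabulary for
the infrastructure steps (S3) saddle / (S4) phase geometry / (S5) Laplace of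
HOME/rh-jensen-prover/g7-work/LINE-PLAN.md. RH-FREE. WHAT THIS IS NOT: definitions and algebraic
identities for the `ζ`-free part of an explicit integrand; nothing here bears on zeros of `ζ` or the
truth of RH.

* `LogBandArc.xiGammaFactor s = ½ s(s−1) Γℝ(s)` (`Γℝ(s) = π^{−s/2}Γ(s/2)`), so that
  `ξ(s) = γ̃(s) ζ(s)` for `Re s > 0`, `s ≠ 1` (`riemannXi_eq_xiGammaFactor_mul`); `γ̃` has no
  zeros in `Re s > 0`, `s ≠ 1` (`xiGammaFactor_ne_zero`), is differentiable there, and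
  `γ̃′/γ̃(s) = 1/s + 1/(s−1) − ½ log π + ½ ψ(s/2)` (`logDeriv_xiGammaFactor_of_re_pos`, the named form of eng-2 g5's `logDeriv_xiGammaFactor`; their Stirling bounds in `JensenLogBandGammaFactorStirling.lean` apply verbatim).
* `LogBandArc.arcModelIntegrand n h c φ` — the `ζ`-FREE arc integrand
  `(d/dφ)(c + h e^{iφ}) · γ̃(½+u) · K_{n,c}(u)`, `u = c + h e^{iφ}`; the true integrand factors as
  `arcIntegrandU n h c φ = arcModelIntegrand n h c φ · ζ(½ + u)` (`arcIntegrandU_eq_model_mul_zeta`)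
  whenever `Re(½ + u) > 0`, `u ≠ ½`.
* `LogBandArc.arcSaddleFn n c u = γ̃′/γ̃(½+u) + 1/u − n/(u−c) − (n+1)/(u+c)` — the logarithmic
  `u`-derivative of the `φ`-DENSITY `γ̃(½+u)·2u·(u−c)^{−n}(u+c)^{−(n+1)}` (the kernel
  `2u((u−c)(u+c))^{−(n+1)}` times the Jacobian `du/dφ = i(u−c)`): the model saddle `u*` of the
  right half-arc about `c` is the zero of `arcSaddleFn n c` near `c + h(n,T)`; its modulus
  `|u* − c| = h*` is the radius on which the window is analysed (reached from `h(n,T)` by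
  `LogBandArc.rightArc_sub_rightArc_eq`).
-/

noncomputable section

-- single-problem summit: `Summit.RiemannHypothesis.RiemannHypothesis.…` is the tree convention
set_option linter.dupNamespace false

open Complex Real

namespace Summit.RiemannHypothesis.RiemannHypothesis.Theorems.JensenPolynomials.LogBandArc

open Literature.NumberTheory.LFunctions

/-! ## The `Γ`-factor of `ξ` -/

/-- The `Γ`-factor of Riemann's `ξ`: `γ̃(s) = ½ s (s − 1) Γℝ(s) = ½ s(s−1) π^{−s/2} Γ(s/2)`, so that
`ξ = γ̃ · ζ`. [folklore] -/
def xiGammaFactor (s : ℂ) : ℂ := s * (s - 1) / 2 * Gammaℝ s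

/-- `ξ(s) = γ̃(s) ζ(s)` for `Re s > 0`, `s ≠ 1` (Titchmarsh §2.1 (2.1.12) with Mathlib's
`ζ = Λ/Γℝ`). [folklore] -/
theorem riemannXi_eq_xiGammaFactor_mul {s : ℂ} (hs : 0 < s.re) (hs1 : s ≠ 1) :
    riemannXi s = xiGammaFactor s * riemannZeta s := by
  have hs0 : s ≠ 0 := fun h => by rw [h] at hs; simp at hs
  have hΓ : Gammaℝ s ≠ 0 := Gammaℝ_ne_zero_of_re_pos hs
  rw [riemannXi_eq_mul_completedRiemannZeta hs0 hs1, riemannZeta_def_of_ne_zero hs0, xiGammaFactor]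
  field_simp

/-- `γ̃(s) ≠ 0` for `Re s > 0`, `s ≠ 1`. [folklore] -/
theorem xiGammaFactor_ne_zero {s : ℂ} (hs : 0 < s.re) (hs1 : s ≠ 1) : xiGammaFactor s ≠ 0 := by
  have hs0 : s ≠ 0 := fun h => by rw [h] at hs; simp at hs
  exact mul_ne_zero (div_ne_zero (mul_ne_zero hs0 (sub_ne_zero.2 hs1)) two_ne_zero)
    (Gammaℝ_ne_zero_of_re_pos hs)

/-- No pole of `Γ(s/2)` in `Re s > 0`. [folklore] -/
theorem half_ne_neg_nat {s : ℂ} (hs : 0 < s.re) (m : ℕ) : s / 2 ≠ -(m : ℂ) := by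
  intro h
  have := congrArg Complex.re h
  simp at this
  linarith

/-- `γ̃` is differentiable at every `s` with `Re s > 0`. [folklore] -/
theorem differentiableAt_xiGammaFactor {s : ℂ} (hs : 0 < s.re) :
    DifferentiableAt ℂ xiGammaFactor s := by
  have hdΓ : DifferentiableAt ℂ Gammaℝ s :=
    (RealZeros.hasDerivAt_Gammaℝ (half_ne_neg_nat hs)).differentiableAt
  unfold xiGammaFactor
  fun_prop

/-- **`γ̃′/γ̃(s) = 1/s + 1/(s−1) − ½ log π + ½ ψ(s/2)`** for `Re s > 0`, `s ≠ 1` — the named-`def`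
form of eng-2 g5's `logDeriv_xiGammaFactor` (`JensenLogBandGammaFactorStirling.lean`, stated for the
lambda `z ↦ z(z−1)/2·Γℝ z`, to which `xiGammaFactor` is definitionally equal); its Stirling
estimates `norm_xiGammaLogDeriv_sub_half_log_le…` (`λ′ = ½ Log(s/2π) + O(1/Im s)`) therefore apply
to `logDeriv xiGammaFactor` verbatim. [folklore] -/
theorem logDeriv_xiGammaFactor_of_re_pos {s : ℂ} (hs : 0 < s.re) (hs1 : s ≠ 1) :
    logDeriv xiGammaFactor s =
      1 / s + 1 / (s - 1) - Complex.log (Real.pi : ℂ) / 2 + Complex.digamma (s / 2) / 2 := by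
  have hs0 : s ≠ 0 := fun h => by rw [h] at hs; simp at hs
  exact logDeriv_xiGammaFactor hs0 hs1 (half_ne_neg_nat hs)

/-! ## The `ζ`-free arc integrand and its factorisation -/

/-- The `ζ`-FREE (model) arc integrand at angle `φ` on the circle `u = c + h e^{iφ}`:
`(d/dφ)(c + h e^{iφ}) · γ̃(½+u) · K_{n,c}(u)`. [folklore] -/
def arcModelIntegrand (n : ℕ) (h : ℝ) (c : ℂ) (φ : ℝ) : ℂ :=
  deriv (circleMap c h) φ * (xiGammaFactor (1 / 2 + circleMap c h φ) * sqKernel n c (circleMap c h φ))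

/-- **Factorisation**: `arcIntegrandU n h c φ = arcModelIntegrand n h c φ · ζ(½ + u)`,
`u = c + h e^{iφ}`, as soon as `Re(½ + u) > 0` and `u ≠ ½` (i.e. `½ + u ≠ 1`). [folklore] -/
theorem arcIntegrandU_eq_model_mul_zeta (n : ℕ) (h : ℝ) (c : ℂ) (φ : ℝ)
    (hre : 0 < (1 / 2 + circleMap c h φ).re) (h1 : 1 / 2 + circleMap c h φ ≠ 1) :
    arcIntegrandU n h c φ =
      arcModelIntegrand n h c φ * riemannZeta (1 / 2 + circleMap c h φ) := by
  rw [arcIntegrandU, arcModelIntegrand, xiSq_sq, riemannXi_eq_xiGammaFactor_mul hre h1]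
  ring

/-! ## The saddle function -/

/-- **The saddle function of the right half-arc about `c`**:
`S_{n,c}(u) = γ̃′/γ̃(½+u) + 1/u − n/(u−c) − (n+1)/(u+c)` — the logarithmic `u`-derivative of
the `φ`-density `γ̃(½+u) · 2u · (u−c)^{−n} (u+c)^{−(n+1)}` of the `ζ`-free arc integrand
(`K_{n,c}(u) du = 2u (u−c)^{−(n+1)}(u+c)^{−(n+1)} · i(u−c) dφ`). The model saddle `u*` is the zero
of `S_{n,c}` near `c + h(n,T)`: to leading order `γ̃′/γ̃ ≈ ℓ_T/2` balances `n/(u−c)`, giving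
`|u* − c| ≈ 2(n+1)/ℓ_T = bandRadius n T` (LINE-PLAN §5: the true ratio `h*/h ∈ [0.96, 1]`).
[folklore] -/
def arcSaddleFn (n : ℕ) (c u : ℂ) : ℂ :=
  logDeriv xiGammaFactor (1 / 2 + u) + 1 / u - n / (u - c) - (n + 1) / (u + c)

/-- The saddle function in closed form (digamma): for `Re(½+u) > 0`, `u ≠ ½`,
`S_{n,c}(u) = 1/(½+u) + 1/(u−½) − ½log π + ½ψ((½+u)/2) + 1/u − n/(u−c) − (n+1)/(u+c)`.
[folklore] -/
theorem arcSaddleFn_eq (n : ℕ) (c : ℂ) {u : ℂ} (hre : 0 < (1 / 2 + u).re) (h1 : 1 / 2 + u ≠ 1) :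
    arcSaddleFn n c u = 1 / (1 / 2 + u) + 1 / (1 / 2 + u - 1) -
      Complex.log (Real.pi : ℂ) / 2 + Complex.digamma ((1 / 2 + u) / 2) / 2 +
      1 / u - n / (u - c) - (n + 1) / (u + c) := by
  rw [arcSaddleFn, logDeriv_xiGammaFactor_of_re_pos hre h1]

/-- **The φ-density and its logarithmic derivative.** On the circle `u = c + h e^{iφ}` (`h ≠ 0`) the
`ζ`-free integrand is `i(u − c) · γ̃(½+u) · K_{n,c}(u)`; at a point where `Re(½+u) > 0`,
`½ + u ≠ 1`, `u ≠ 0` and `u ≠ ±c`, its logarithmic derivative in `φ` equals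
`S_{n,c}(u) · i(u − c)` — so the saddle of the `φ`-density is exactly a zero of `S_{n,c}`.
Here: the algebraic identity `d/dφ (c + h e^{iφ}) = i (u − c)`. [folklore] -/
theorem deriv_circleMap_eq_I_mul_sub (c : ℂ) (h : ℝ) (φ : ℝ) :
    deriv (circleMap c h) φ = I * (circleMap c h φ - c) := by
  rw [deriv_circleMap, circleMap, circleMap]
  ring

end Summit.RiemannHypothesis.RiemannHypothesis.Theorems.JensenPolynomials.LogBandArc

end
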